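import Literature.MathematicalPhysics.QuantumFieldTheory.ConformalBootstrap3D.HRCoeffTM
import Literature.MathematicalPhysics.QuantumFieldTheory.ConformalBootstrap3D.PointFunctionalNodeCell
import HarnessLib

/-!
# Kernel v3, step M: node head sums as Taylor models (integer moment folds)

[folklore] validated numerics on top of [cite: HogervorstRychkov2013, §3 eq. (3.9)].

For a node `(x, y)` (rationals, `u = xy`), an even spin `ℓ` and a cell centre `A`, the node head sum
`H(Δ) = Σ_{n ≤ nF, j ≤ ℓ+nF} A_{n,j}(Δ) · u^{(n-j)/2} 𝒫_j(x,y)` (`nodeHead`, file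
`PointFunctionalNodeCell`) is enclosed, as a function of `ρ = Δ - A` on `|ρ| ≤ 2^{-e}`, in a
degree-`D` Taylor model obtained from the Taylor models of the coefficients `A_{n,j}(A+ρ)`
(`HRTM.rows`, file `HRCoeffTM`) by ONE pass of integer folds: with the floors
`U_n = ⌊u^{⌊n/2⌋} S⌋`, `V_j = ⌊u^{-⌊j/2⌋} 𝒫_j S⌋` (for even `ℓ` only same-parity `(n, j)` occur, so
`u^{(n-j)/2} = u^{⌊n/2⌋} u^{-⌊j/2⌋}`), every coefficient interval `[lo, hi]` of `A_{n,j}` contributes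
`[selLo lo V_j, selHi hi V_j] ∋ a · (u^{-⌊j/2⌋}𝒫_j S) · S` (sign-selected endpoint products), the
row sums are multiplied by `[U_n, U_n + 1]` the same way, and the level sums are divided by `S²`
once (`momPoly`).  Main theorem: `tmem_moments`.
-/

namespace Literature.MathematicalPhysics.QuantumFieldTheory.ConformalBootstrap3D

namespace PKTM

open Literature.Analysis.ValidatedNumerics (rall vget vtab vget_vtab length_vtab)
open Literature.Analysis.ValidatedNumerics.PolyMP
open Literature.Analysis.ValidatedNumerics.NumericsMP
open Literature.Analysis.ValidatedNumerics.Numerics (cdiv fdiv_mul_le_real le_cdiv_mul_real)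
open PointKernel (legTab vget_legTab zLegendreQ cast_zLegendreQ zLegendreQ_nonneg)
open Finset Real

/-! ### The integer kernel -/

/-- `⌊x S⌋`. [folklore] -/
def flS (S : ℕ) (x : ℚ) : ℤ := ⌊x * (S : ℚ)⌋

/-- Floors `U_{nF-i} = ⌊u^{⌊(nF-i)/2⌋} S⌋`, newest level first (the order of `HRTM.rows`). [folklore] -/
def uTabR (S : ℕ) (u : ℚ) (nF : ℕ) : List ℤ := vtab (nF + 1) fun i => flS S (u ^ ((nF - i) / 2))

/-- Floors `V_j = ⌊u^{-⌊j/2⌋} 𝒫_j(x,y) S⌋`, `j ≤ J`, from a Legendre table `lt`. [folklore] -/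
def vTab (S : ℕ) (u : ℚ) (lt : List ℚ) (J : ℕ) : List ℤ :=
  vtab (J + 1) fun j => flS S (vget lt j / u ^ (j / 2))

/-- lower endpoint of `[lo, ·] · [v, v+1]` for `v ≥ 0`. [folklore] -/
def selLo (lo v : ℤ) : ℤ := if lo < 0 then lo * (v + 1) else lo * v

/-- upper endpoint of `[·, hi] · [v, v+1]` for `v ≥ 0`. [folklore] -/
def selHi (hi v : ℤ) : ℤ := if hi < 0 then hi * v else hi * (v + 1)

/-- add `P · [v, v+1]` coefficientwise to an accumulator of `(lo, hi)` pairs. [folklore] -/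
def accPair : IPoly → ℤ → List (ℤ × ℤ) → List (ℤ × ℤ)
  | I :: P, v, a :: acc => (a.1 + selLo I.lo v, a.2 + selHi I.hi v) :: accPair P v acc
  | _, _, acc => acc

/-- add `Σ_j P_j · [V_j, V_j+1]` over one row. [folklore] -/
def accRow : List IPoly → List ℤ → List (ℤ × ℤ) → List (ℤ × ℤ)
  | P :: row, v :: vt, acc => accRow row vt (accPair P v acc)
  | _, _, acc => acc

/-- the zero accumulator of `D + 1` coefficients. [folklore] -/
def zacc (D : ℕ) : List (ℤ × ℤ) := vtab (D + 1) fun _ => ((0 : ℤ), (0 : ℤ))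

/-- add `inner · [un, un+1]` coefficientwise. [folklore] -/
def accOuter : List (ℤ × ℤ) → ℤ → List (ℤ × ℤ) → List (ℤ × ℤ)
  | b :: inner, un, a :: acc => (a.1 + selLo b.1 un, a.2 + selHi b.2 un) :: accOuter inner un acc
  | _, _, acc => acc

/-- the level loop: `Σ_n [U_n, U_n+1] · (Σ_j P_{n,j} · [V_j, V_j+1])`. [folklore] -/
def momentsRows : List (List IPoly) → List ℤ → List ℤ → ℕ → List (ℤ × ℤ) → List (ℤ × ℤ)
  | row :: rs, un :: utr, vt, D, acc => momentsRows rs utr vt D (accOuter (accRow row vt (zacc D)) un acc)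
  | _, _, _, _, acc => acc

/-- the `D + 1` moment pairs `(lo_i, hi_i)` (scale `S³`). [folklore] -/
def moments (rs : List (List IPoly)) (utr vt : List ℤ) (D : ℕ) : List (ℤ × ℤ) :=
  momentsRows rs utr vt D (zacc D)

/-- the moment Taylor model (scale `S`): one outward division by `S²` per coefficient. [folklore] -/
def momPoly (S D : ℕ) (ms : List (ℤ × ℤ)) : IPoly :=
  (List.range (D + 1)).map fun i =>
    ⟨(ms.getD i (0, 0)).1 / ((S * S : ℕ) : ℤ), cdiv (ms.getD i (0, 0)).2 ((S * S : ℕ) : ℤ)⟩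

/-- **The node moment model**: rows of `HRTM.rows`, floors of the node, one fold. [folklore] -/
def nodeMomTM (S : ℕ) (A : ℚ) (ℓ e D nF : ℕ) (x y : ℚ) : IPoly :=
  momPoly S D (moments (HRTM.rows S A ℓ e D nF) (uTabR S (x * y) nF)
    (vTab S (x * y) (legTab (ℓ + nF) x y) (ℓ + nF)) D)

/-! ### Sign-selected endpoint products -/

/-- [folklore] -/
theorem selLo_le {r U : ℤ} {X a : ℝ} (hr : (r : ℝ) ≤ X) (ha0 : 0 ≤ a) (hU : (U : ℝ) ≤ a)
    (hU1 : a ≤ (U : ℝ) + 1) : ((selLo r U : ℤ) : ℝ) ≤ X * a := by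
  unfold selLo
  split_ifs with h
  · have hr0 : (r : ℝ) < 0 := by exact_mod_cast h
    push_cast
    by_cases hX : 0 ≤ X
    · nlinarith [mul_nonneg hX ha0]
    · have hX : X < 0 := lt_of_not_ge hX
      nlinarith [mul_le_mul_of_nonpos_left hU1 hX.le]
  · have hr0 : (0 : ℝ) ≤ r := by exact_mod_cast not_lt.mp h
    push_cast
    nlinarith [mul_le_mul_of_nonneg_left hU hr0, mul_le_mul_of_nonneg_right hr ha0]

/-- [folklore] -/
theorem le_selHi {r U : ℤ} {X a : ℝ} (hr : X ≤ (r : ℝ)) (ha0 : 0 ≤ a) (hU0 : (0 : ℝ) ≤ U)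
    (hU : (U : ℝ) ≤ a) (hU1 : a ≤ (U : ℝ) + 1) : X * a ≤ ((selHi r U : ℤ) : ℝ) := by
  unfold selHi
  split_ifs with h
  · have hr0 : (r : ℝ) < 0 := by exact_mod_cast h
    push_cast
    have hX : X < 0 := lt_of_le_of_lt hr hr0
    nlinarith [mul_le_mul_of_nonpos_left hU hX.le, mul_le_mul_of_nonneg_right hr hU0]
  · have hr0 : (0 : ℝ) ≤ r := by exact_mod_cast not_lt.mp h
    push_cast
    by_cases hX : X ≤ 0
    · nlinarith [mul_nonpos_of_nonpos_of_nonneg hX ha0]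
    · have hX : 0 < X := lt_of_not_ge hX
      nlinarith [mul_le_mul_of_nonneg_left hU1 hX.le, mul_le_mul_of_nonneg_right hr (by linarith : (0:ℝ) ≤ U + 1)]

/-- [folklore] -/
@[simp] theorem selLo_zero (v : ℤ) : selLo 0 v = 0 := by simp [selLo]

/-- [folklore] -/
@[simp] theorem selHi_zero (v : ℤ) : selHi 0 v = 0 := by simp [selHi]

/-! ### The folds, coefficient by coefficient -/

/-- [folklore] -/
theorem accPair_nil (v : ℤ) (acc : List (ℤ × ℤ)) : accPair [] v acc = acc := by
  cases acc <;> rfl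

/-- [folklore] -/
theorem accPair_cons_cons (I : MI) (P : IPoly) (v : ℤ) (a : ℤ × ℤ) (acc : List (ℤ × ℤ)) :
    accPair (I :: P) v (a :: acc) = (a.1 + selLo I.lo v, a.2 + selHi I.hi v) :: accPair P v acc :=
  rfl

/-- [folklore] -/
theorem length_accPair : ∀ (P : IPoly) (v : ℤ) (acc : List (ℤ × ℤ)),
    (accPair P v acc).length = acc.length
  | [], v, acc => by rw [accPair_nil]
  | _ :: _, _, [] => rfl
  | I :: P, v, a :: acc => by rw [accPair_cons_cons, List.length_cons, length_accPair P v acc]; rfl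

/-- [folklore] -/
theorem getD_accPair : ∀ (P : IPoly) (v : ℤ) (acc : List (ℤ × ℤ)) (i : ℕ), i < acc.length →
    (accPair P v acc).getD i (0, 0) =
      ((acc.getD i (0, 0)).1 + selLo (HRTM.cf P i).lo v, (acc.getD i (0, 0)).2 + selHi (HRTM.cf P i).hi v)
  | [], v, acc, i, _ => by simp [accPair_nil, HRTM.cf, HRTM.zI]
  | _ :: _, _, [], i, hi => by simp at hi
  | I :: P, v, a :: acc, 0, _ => by simp [accPair_cons_cons, HRTM.cf]
  | I :: P, v, a :: acc, i + 1, hi => by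
      simp only [accPair_cons_cons, List.getD_cons_succ, HRTM.cf]
      exact getD_accPair P v acc i (by simpa using hi)

/-- [folklore] -/
theorem accRow_nil (vt : List ℤ) (acc : List (ℤ × ℤ)) : accRow [] vt acc = acc := by
  cases vt <;> rfl

/-- [folklore] -/
theorem accRow_cons_cons (P : IPoly) (row : List IPoly) (v : ℤ) (vt : List ℤ) (acc : List (ℤ × ℤ)) :
    accRow (P :: row) (v :: vt) acc = accRow row vt (accPair P v acc) := rfl

/-- [folklore] -/
theorem length_accRow : ∀ (row : List IPoly) (vt : List ℤ) (acc : List (ℤ × ℤ)),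
    (accRow row vt acc).length = acc.length
  | [], vt, acc => by rw [accRow_nil]
  | _ :: _, [], _ => rfl
  | P :: row, v :: vt, acc => by rw [accRow_cons_cons, length_accRow row vt, length_accPair]

/-- [folklore] -/
theorem getD_accRow : ∀ (row : List IPoly) (vt : List ℤ) (acc : List (ℤ × ℤ)) (i : ℕ),
    row.length ≤ vt.length → i < acc.length →
    (accRow row vt acc).getD i (0, 0) =
      ((acc.getD i (0, 0)).1 + ∑ j ∈ range row.length, selLo (HRTM.cf (row.getD j []) i).lo (vt.getD j 0),
       (acc.getD i (0, 0)).2 + ∑ j ∈ range row.length, selHi (HRTM.cf (row.getD j []) i).hi (vt.getD j 0))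
  | [], vt, acc, i, _, _ => by simp [accRow_nil]
  | _ :: _, [], _, _, h, _ => by simp at h
  | P :: row, v :: vt, acc, i, h, hi => by
      rw [accRow_cons_cons, getD_accRow row vt _ i (by simpa using h) (by rw [length_accPair]; exact hi),
        getD_accPair P v acc i hi]
      simp only [List.length_cons, List.getD_cons_succ, List.getD_cons_zero, sum_range_succ']
      ext <;> ring

/-- [folklore] -/
theorem accOuter_nil (un : ℤ) (acc : List (ℤ × ℤ)) : accOuter [] un acc = acc := by
  cases acc <;> rfl

/-- [folklore] -/
theorem accOuter_cons_cons (b : ℤ × ℤ) (inner : List (ℤ × ℤ)) (un : ℤ) (a : ℤ × ℤ)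
    (acc : List (ℤ × ℤ)) :
    accOuter (b :: inner) un (a :: acc) = (a.1 + selLo b.1 un, a.2 + selHi b.2 un) :: accOuter inner un acc :=
  rfl

/-- [folklore] -/
theorem length_accOuter : ∀ (inner : List (ℤ × ℤ)) (un : ℤ) (acc : List (ℤ × ℤ)),
    (accOuter inner un acc).length = acc.length
  | [], un, acc => by rw [accOuter_nil]
  | _ :: _, _, [] => rfl
  | b :: inner, un, a :: acc => by
      rw [accOuter_cons_cons, List.length_cons, length_accOuter inner un acc]; rfl

/-- [folklore] -/
theorem getD_accOuter : ∀ (inner : List (ℤ × ℤ)) (un : ℤ) (acc : List (ℤ × ℤ)) (i : ℕ), i < acc.length →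
    (accOuter inner un acc).getD i (0, 0) =
      ((acc.getD i (0, 0)).1 + selLo (inner.getD i (0, 0)).1 un,
       (acc.getD i (0, 0)).2 + selHi (inner.getD i (0, 0)).2 un)
  | [], un, acc, i, _ => by simp [accOuter_nil]
  | _ :: _, _, [], i, hi => by simp at hi
  | b :: inner, un, a :: acc, 0, _ => by simp [accOuter_cons_cons]
  | b :: inner, un, a :: acc, i + 1, hi => by
      simp only [accOuter_cons_cons, List.getD_cons_succ]
      exact getD_accOuter inner un acc i (by simpa using hi)

/-- [folklore] -/
theorem momentsRows_nil (utr vt : List ℤ) (D : ℕ) (acc : List (ℤ × ℤ)) :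
    momentsRows [] utr vt D acc = acc := by
  cases utr <;> rfl

/-- [folklore] -/
theorem momentsRows_cons_cons (row : List IPoly) (rs : List (List IPoly)) (un : ℤ) (utr vt : List ℤ)
    (D : ℕ) (acc : List (ℤ × ℤ)) :
    momentsRows (row :: rs) (un :: utr) vt D acc =
      momentsRows rs utr vt D (accOuter (accRow row vt (zacc D)) un acc) := rfl

/-- [folklore] -/
theorem length_momentsRows : ∀ (rs : List (List IPoly)) (utr vt : List ℤ) (D : ℕ) (acc : List (ℤ × ℤ)),
    (momentsRows rs utr vt D acc).length = acc.length
  | [], utr, vt, D, acc => by rw [momentsRows_nil]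
  | _ :: _, [], _, _, _ => rfl
  | row :: rs, un :: utr, vt, D, acc => by
      rw [momentsRows_cons_cons, length_momentsRows rs utr vt D, length_accOuter]

/-- [folklore] -/
theorem getD_momentsRows : ∀ (rs : List (List IPoly)) (utr vt : List ℤ) (D : ℕ) (acc : List (ℤ × ℤ))
    (i : ℕ), rs.length ≤ utr.length → i < acc.length →
    (momentsRows rs utr vt D acc).getD i (0, 0) =
      ((acc.getD i (0, 0)).1 +
          ∑ m ∈ range rs.length, selLo ((accRow (rs.getD m []) vt (zacc D)).getD i (0, 0)).1 (utr.getD m 0),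
       (acc.getD i (0, 0)).2 +
          ∑ m ∈ range rs.length, selHi ((accRow (rs.getD m []) vt (zacc D)).getD i (0, 0)).2 (utr.getD m 0))
  | [], utr, vt, D, acc, i, _, _ => by simp [momentsRows_nil]
  | _ :: _, [], _, _, _, _, h, _ => by simp at h
  | row :: rs, un :: utr, vt, D, acc, i, h, hi => by
      rw [momentsRows_cons_cons, getD_momentsRows rs utr vt D _ i (by simpa using h)
        (by rw [length_accOuter]; exact hi), getD_accOuter _ un acc i hi]
      simp only [List.length_cons, List.getD_cons_succ, List.getD_cons_zero, sum_range_succ']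
      ext <;> ring

/-- [folklore] -/
theorem getD_zacc (D i : ℕ) : (zacc D).getD i (0, 0) = (0, 0) := by
  unfold zacc
  rw [HRTM.getD_vtab]
  split_ifs <;> rfl

/-- [folklore] -/
@[simp] theorem length_zacc (D : ℕ) : (zacc D).length = D + 1 := by simp [zacc]

/-- [folklore] -/
theorem length_moments (rs : List (List IPoly)) (utr vt : List ℤ) (D : ℕ) :
    (moments rs utr vt D).length = D + 1 := by
  rw [moments, length_momentsRows, length_zacc]

/-- **The moment pairs in closed form.** [folklore] -/
theorem getD_moments (rs : List (List IPoly)) (utr vt : List ℤ) (D : ℕ) (hrs : rs.length ≤ utr.length)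
    (hvt : ∀ m < rs.length, (rs.getD m []).length ≤ vt.length) {i : ℕ} (hi : i < D + 1) :
    (moments rs utr vt D).getD i (0, 0) =
      (∑ m ∈ range rs.length, selLo
          (∑ j ∈ range (rs.getD m []).length, selLo (HRTM.cf ((rs.getD m []).getD j []) i).lo (vt.getD j 0))
          (utr.getD m 0),
       ∑ m ∈ range rs.length, selHi
          (∑ j ∈ range (rs.getD m []).length, selHi (HRTM.cf ((rs.getD m []).getD j []) i).hi (vt.getD j 0))
          (utr.getD m 0)) := by
  rw [moments, getD_momentsRows rs utr vt D _ i hrs (by simpa using hi), getD_zacc]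
  simp only [zero_add, Prod.mk.injEq]
  refine ⟨sum_congr rfl fun m hm => ?_, sum_congr rfl fun m hm => ?_⟩
  · rw [getD_accRow _ _ _ i (hvt m (mem_range.mp hm)) (by simpa using hi), getD_zacc]
    simp
  · rw [getD_accRow _ _ _ i (hvt m (mem_range.mp hm)) (by simpa using hi), getD_zacc]
    simp

/-! ### Shapes of `HRTM.rows` -/

/-- [folklore] -/
theorem length_rows (S : ℕ) (A : ℚ) (ℓ e D : ℕ) : ∀ nF, (HRTM.rows S A ℓ e D nF).length = nF + 1
  | 0 => by simp [HRTM.rows]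
  | n + 1 => by simp [HRTM.rows, length_rows S A ℓ e D n]

/-- level `nF - m` is stored at position `m` and has `ℓ + (nF - m) + 1` entries. [folklore] -/
theorem length_getD_rows (S : ℕ) (A : ℚ) (ℓ e D : ℕ) :
    ∀ nF m, m ≤ nF → ((HRTM.rows S A ℓ e D nF).getD m []).length = ℓ + (nF - m) + 1
  | 0, m, hm => by
      obtain rfl : m = 0 := by omega
      simp [HRTM.rows]
  | n + 1, 0, _ => by
      simp only [HRTM.rows, List.getD_cons_zero, HRTM.stepRow, length_vtab]
      omega
  | n + 1, m + 1, hm => by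
      simp only [HRTM.rows, List.getD_cons_succ]
      rw [length_getD_rows S A ℓ e D n m (by omega)]
      omega

/-- position `m` / entry `j` is `rowEntry` of level `nF - m`. [folklore] -/
theorem getD_getD_eq_rowEntry (rs : List (List IPoly)) {nF m : ℕ} (hm : m ≤ nF) (j : ℕ) :
    (rs.getD m []).getD j [] = HRTM.rowEntry rs nF (nF - m) j := by
  rw [HRTM.rowEntry, Nat.sub_sub_self hm]

/-! ### Floors -/

/-- [folklore] -/
theorem flS_le (S : ℕ) (q : ℚ) : ((flS S q : ℤ) : ℝ) ≤ (q : ℝ) * S := by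
  unfold flS
  have h : ((⌊q * (S : ℚ)⌋ : ℤ) : ℚ) ≤ q * S := Int.floor_le _
  have h' : (((⌊q * (S : ℚ)⌋ : ℤ) : ℚ) : ℝ) ≤ ((q * S : ℚ) : ℝ) := by exact_mod_cast h
  push_cast at h'
  exact h'

/-- [folklore] -/
theorem le_flS_add_one (S : ℕ) (q : ℚ) : (q : ℝ) * S ≤ ((flS S q : ℤ) : ℝ) + 1 := by
  unfold flS
  have h : q * S < ((⌊q * (S : ℚ)⌋ : ℤ) : ℚ) + 1 := Int.lt_floor_add_one _
  have h' : ((q * S : ℚ) : ℝ) < ((((⌊q * (S : ℚ)⌋ : ℤ) : ℚ) + 1 : ℚ) : ℝ) := by exact_mod_cast h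
  push_cast at h'
  exact h'.le

/-- [folklore] -/
theorem flS_nonneg (S : ℕ) {q : ℚ} (hq : 0 ≤ q) : (0 : ℝ) ≤ ((flS S q : ℤ) : ℝ) := by
  unfold flS
  exact_mod_cast Int.floor_nonneg.mpr (mul_nonneg hq (Nat.cast_nonneg S))

/-- `PMem` of two `range` maps from indexwise membership below the length. [folklore] -/
theorem pmem_map_range_lt {S : ℕ} (K : ℕ) {f : ℕ → ℝ} {F : ℕ → MI}
    (h : ∀ k < K, MI.mem S (f k) (F k)) : PMem S ((List.range K).map f) ((List.range K).map F) := by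
  have e1 : (List.range K).map f = (List.range K).map fun k => if k < K then f k else 0 :=
    List.map_congr_left fun k hk => by rw [if_pos (List.mem_range.mp hk)]
  have e2 : (List.range K).map F = (List.range K).map fun k => if k < K then F k else HRTM.zI :=
    List.map_congr_left fun k hk => by rw [if_pos (List.mem_range.mp hk)]
  rw [e1, e2]
  refine HRTM.pmem_map_range K fun k => ?_
  by_cases hk : k < K
  · rw [if_pos hk, if_pos hk]; exact h k hk
  · rw [if_neg hk, if_neg hk]; exact HRTM.mem_zI S

/-- same-parity exponent: `(n - j)/2 = ⌊n/2⌋ - ⌊j/2⌋`. [folklore] -/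
theorem rpow_half_sub_eq {u : ℝ} (hu : 0 < u) {n j : ℕ} (h : n % 2 = j % 2) :
    u ^ (((n : ℝ) - j) / 2) = u ^ (n / 2) / u ^ (j / 2) := by
  have hn : (n : ℝ) = 2 * ((n / 2 : ℕ) : ℝ) + ((n % 2 : ℕ) : ℝ) := by exact_mod_cast (Nat.div_add_mod n 2).symm
  have hj : (j : ℝ) = 2 * ((j / 2 : ℕ) : ℝ) + ((j % 2 : ℕ) : ℝ) := by exact_mod_cast (Nat.div_add_mod j 2).symm
  have hm : ((n % 2 : ℕ) : ℝ) = ((j % 2 : ℕ) : ℝ) := by exact_mod_cast h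
  have h3 : ((n : ℝ) - j) / 2 = ((n / 2 : ℕ) : ℝ) - ((j / 2 : ℕ) : ℝ) := by linarith
  rw [h3, Real.rpow_sub hu, Real.rpow_natCast, Real.rpow_natCast]

/-! ### The main theorem -/

/-- **Node head sums as Taylor models.** For even `ℓ`, a positive node `(x, y)` and the rows of
`HRTM.rows` under the pivot condition, `ρ ↦ H(x, y, A + ρ)` lies in `nodeMomTM` on `|ρ| ≤ 2^{-e}`.
[cite: HogervorstRychkov2013, §3 eq. (3.9)] -/
theorem tmem_moments {S : ℕ} (hS : 0 < S) {A : ℚ} {ℓ e D nF : ℕ} (hℓ : Even ℓ) (hD : 1 ≤ D)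
    (hpiv : HRTM.pivOK A ℓ e nF = true) {x y : ℚ} (hx : 0 < x) (hy : 0 < y) :
    TMem S ((1 : ℚ) / 2 ^ e) (fun ρ => nodeHead ℓ nF (x : ℝ) (y : ℝ) ((A : ℝ) + ρ))
      (nodeMomTM S A ℓ e D nF x y) := by
  intro ρ hρ
  set rs := HRTM.rows S A ℓ e D nF with hrs
  -- witnesses of the coefficient models at `ρ`
  have hW : ∀ n j, ∃ as : List ℝ, n ≤ nF →
      PMem S as (HRTM.rowEntry rs nF n j) ∧ hrCoeff ((A : ℝ) + ρ) ℓ n j = evalR as ρ := by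
    intro n j
    by_cases hn : n ≤ nF
    · obtain ⟨as, h1, h2⟩ := HRTM.tmem_rows (S := S) hD hpiv hn j ρ hρ
      exact ⟨as, fun _ => ⟨h1, h2⟩⟩
    · exact ⟨[], fun h => absurd h hn⟩
  choose as has using hW
  have hlen : ∀ n ≤ nF, ∀ j, (as n j).length ≤ D + 1 := fun n hn j => by
    rw [(has n j hn).1.length_eq]; exact HRTM.length_rowEntry_le hD hpiv hn j
  -- the real factors
  set uq : ℚ := x * y with huq
  have huq0 : 0 < uq := mul_pos hx hy
  set u : ℝ := (x : ℝ) * y with hu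
  have hu0 : 0 < u := by rw [hu]; exact_mod_cast mul_pos hx hy
  have hcast : ((uq : ℚ) : ℝ) = u := by rw [huq, hu]; push_cast; rfl
  set α : ℕ → ℝ := fun n => u ^ (n / 2) with hα
  set β : ℕ → ℝ := fun j => zLegendre j (x : ℝ) (y : ℝ) / u ^ (j / 2) with hβ
  have hα0 : ∀ n, 0 ≤ α n := fun n => pow_nonneg hu0.le _
  have hβ0 : ∀ j, 0 ≤ β j := fun j =>
    div_nonneg (zLegendre_nonneg j (by exact_mod_cast hx.le) (by exact_mod_cast hy.le)) (pow_nonneg hu0.le _)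
  set g : ℕ → ℝ := fun i => ∑ m ∈ range (nF + 1), α (nF - m) *
      ∑ j ∈ range (ℓ + (nF - m) + 1), (as (nF - m) j).getD i 0 * β j with hg
  -- floors
  set utr := uTabR S uq nF with hutr
  set vt := vTab S uq (legTab (ℓ + nF) x y) (ℓ + nF) with hvt
  have hrs_len : rs.length = nF + 1 := length_rows S A ℓ e D nF
  have hutr_len : utr.length = nF + 1 := by simp [hutr, uTabR]
  have hvt_len : vt.length = ℓ + nF + 1 := by simp [hvt, vTab]
  have hrow_len : ∀ m < rs.length, (rs.getD m []).length = ℓ + (nF - m) + 1 := fun m hm =>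
    length_getD_rows S A ℓ e D nF m (by omega)
  have hU : ∀ m < nF + 1, ((utr.getD m 0 : ℤ) : ℝ) ≤ α (nF - m) * S ∧
      α (nF - m) * S ≤ ((utr.getD m 0 : ℤ) : ℝ) + 1 ∧ (0 : ℝ) ≤ ((utr.getD m 0 : ℤ) : ℝ) := by
    intro m hm
    have e1 : utr.getD m 0 = flS S (uq ^ ((nF - m) / 2)) := by
      rw [hutr, uTabR, HRTM.getD_vtab, if_pos hm]
    have e2 : α (nF - m) = ((uq ^ ((nF - m) / 2) : ℚ) : ℝ) := by
      simp only [hα, ← hcast, Rat.cast_pow]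
    rw [e1, e2]
    exact ⟨flS_le S _, le_flS_add_one S _, flS_nonneg S (pow_nonneg huq0.le _)⟩
  have hV : ∀ j < ℓ + nF + 1, ((vt.getD j 0 : ℤ) : ℝ) ≤ β j * S ∧
      β j * S ≤ ((vt.getD j 0 : ℤ) : ℝ) + 1 ∧ (0 : ℝ) ≤ ((vt.getD j 0 : ℤ) : ℝ) := by
    intro j hj
    have e1 : vt.getD j 0 = flS S (zLegendreQ j x y / uq ^ (j / 2)) := by
      rw [hvt, vTab, HRTM.getD_vtab, if_pos hj, vget_legTab (by omega)]
    have e2 : β j = ((zLegendreQ j x y / uq ^ (j / 2) : ℚ) : ℝ) := by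
      simp only [hβ, ← hcast, Rat.cast_div, Rat.cast_pow, cast_zLegendreQ]
    rw [e1, e2]
    exact ⟨flS_le S _, le_flS_add_one S _,
      flS_nonneg S (div_nonneg (zLegendreQ_nonneg j hx.le hy.le) (pow_nonneg huq0.le _))⟩
  -- coefficient membership: `lo_{n,j,i} ≤ a_{n,j,i} S ≤ hi_{n,j,i}`
  have hA : ∀ m < nF + 1, ∀ j i, MI.mem S ((as (nF - m) j).getD i 0) (HRTM.cf ((rs.getD m []).getD j []) i) := by
    intro m hm j i
    rw [getD_getD_eq_rowEntry rs (by omega : m ≤ nF)]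
    exact HRTM.mem_cf (has (nF - m) j (by omega)).1 i
  refine ⟨(List.range (D + 1)).map g, ?_, ?_⟩
  · -- membership of the moments
    unfold nodeMomTM momPoly
    refine pmem_map_range_lt (D + 1) fun i hi => ?_
    have hSS : (0 : ℤ) < ((S * S : ℕ) : ℤ) := by exact_mod_cast Nat.mul_pos hS hS
    have hms := getD_moments rs utr vt D (by rw [hrs_len, hutr_len])
      (fun m hm => by rw [hrow_len m hm, hvt_len]; have := hrs_len; omega) hi
    -- the scaled target
    have hgS : g i * S ^ 3 = ∑ m ∈ range (nF + 1),
        (∑ j ∈ range (ℓ + (nF - m) + 1), ((as (nF - m) j).getD i 0 * S) * (β j * S)) * (α (nF - m) * S) := by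
      rw [hg, sum_mul]
      refine sum_congr rfl fun m _ => ?_
      simp only [mul_sum, sum_mul]
      refine sum_congr rfl fun j _ => ?_
      ring
    have hlo : (((moments rs utr vt D).getD i (0, 0)).1 : ℝ) ≤ g i * S ^ 3 := by
      rw [hms, hgS]
      push_cast
      rw [hrs_len]
      refine sum_le_sum fun m hm => ?_
      have hm' := mem_range.mp hm
      obtain ⟨hU1, hU2, hU3⟩ := hU m hm'
      refine selLo_le ?_ (mul_nonneg (hα0 _) (Nat.cast_nonneg S)) hU1 hU2
      rw [hrow_len m (by rw [hrs_len]; exact hm')]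
      push_cast
      refine sum_le_sum fun j hj => ?_
      have hj' : j < ℓ + nF + 1 := by have := mem_range.mp hj; omega
      obtain ⟨hV1, hV2, hV3⟩ := hV j hj'
      exact selLo_le (hA m hm' j i).1 (mul_nonneg (hβ0 _) (Nat.cast_nonneg S)) hV1 hV2
    have hhi : g i * S ^ 3 ≤ (((moments rs utr vt D).getD i (0, 0)).2 : ℝ) := by
      rw [hms, hgS]
      push_cast
      rw [hrs_len]
      refine sum_le_sum fun m hm => ?_
      have hm' := mem_range.mp hm
      obtain ⟨hU1, hU2, hU3⟩ := hU m hm'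
      refine le_selHi ?_ (mul_nonneg (hα0 _) (Nat.cast_nonneg S)) hU3 hU1 hU2
      rw [hrow_len m (by rw [hrs_len]; exact hm')]
      push_cast
      refine sum_le_sum fun j hj => ?_
      have hj' : j < ℓ + nF + 1 := by have := mem_range.mp hj; omega
      obtain ⟨hV1, hV2, hV3⟩ := hV j hj'
      exact le_selHi (hA m hm' j i).2 (mul_nonneg (hβ0 _) (Nat.cast_nonneg S)) hV3 hV1 hV2
    have hS3 : (S : ℝ) ^ 3 = S * ((S * S : ℕ) : ℝ) := by push_cast; ring
    have hSSr : (0 : ℝ) < ((S * S : ℕ) : ℤ) := by exact_mod_cast hSS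
    simp only [MI.mem]
    constructor
    · have h1 := fdiv_mul_le_real (a := ((moments rs utr vt D).getD i (0, 0)).1) hSS
      have h2 : g i * S * (((S * S : ℕ) : ℤ) : ℝ) = g i * S ^ 3 := by push_cast; ring
      nlinarith
    · have h1 := le_cdiv_mul_real (a := ((moments rs utr vt D).getD i (0, 0)).2) hSS
      have h2 : g i * S * (((S * S : ℕ) : ℤ) : ℝ) = g i * S ^ 3 := by push_cast; ring
      nlinarith
  · -- the identity `H(A + ρ) = Σ_i g_i ρ^i`
    rw [evalR_map_range]
    -- each head term through its witness
    have hterm : ∀ n ≤ nF, ∀ j, hrCoeff ((A : ℝ) + ρ) ℓ n j * (u ^ (((n : ℝ) - j) / 2) * zLegendre j (x : ℝ) (y : ℝ))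
        = evalR (as n j) ρ * (α n * β j) := by
      intro n hn j
      by_cases hR : InDescendantRange ℓ n j
      · have hpar : n % 2 = j % 2 := by
          obtain ⟨k, hk⟩ := hℓ; have := hR.2.2; omega
        simp only [hα, hβ]
        rw [(has n j hn).2, rpow_half_sub_eq hu0 hpar]
        ring
      · have h0 := hrCoeff_eq_zero_of_not_inDescendantRange ((A : ℝ) + ρ) hR
        rw [← (has n j hn).2, h0, zero_mul, zero_mul]
    have hzero : ∀ n ≤ nF, ∀ j, ℓ + n + 1 ≤ j → evalR (as n j) ρ * (α n * β j) = 0 := by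
      intro n hn j hj
      have hR : ¬ InDescendantRange ℓ n j := fun h => by have := h.2.1; omega
      rw [← (has n j hn).2, hrCoeff_eq_zero_of_not_inDescendantRange _ hR, zero_mul]
    have hL : nodeHead ℓ nF (x : ℝ) (y : ℝ) ((A : ℝ) + ρ) = ∑ m ∈ range (nF + 1),
        ∑ j ∈ range (ℓ + (nF - m) + 1), evalR (as (nF - m) j) ρ * (α (nF - m) * β j) := by
      unfold nodeHead headSet
      rw [sum_product, ← sum_range_reflect _ (nF + 1)]
      refine sum_congr rfl fun m hm => ?_
      have hm' := mem_range.mp hm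
      have e : nF + 1 - 1 - m = nF - m := by omega
      rw [e]
      have h1 : ∑ j ∈ range (ℓ + nF + 1), hrCoeff ((A : ℝ) + ρ) ℓ (nF - m) j *
            (u ^ ((((nF - m : ℕ) : ℝ) - j) / 2) * zLegendre j (x : ℝ) (y : ℝ))
          = ∑ j ∈ range (ℓ + nF + 1), evalR (as (nF - m) j) ρ * (α (nF - m) * β j) :=
        sum_congr rfl fun j _ => hterm (nF - m) (by omega) j
      have h2 : ∑ j ∈ range (ℓ + (nF - m) + 1), evalR (as (nF - m) j) ρ * (α (nF - m) * β j)
          = ∑ j ∈ range (ℓ + nF + 1), evalR (as (nF - m) j) ρ * (α (nF - m) * β j) :=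
        sum_subset (range_mono (by omega)) fun j hj hj' =>
          hzero (nF - m) (by omega) j (by have := mem_range.mp hj; simp at hj'; omega)
      rw [h2, ← h1]
    show nodeHead ℓ nF (x : ℝ) (y : ℝ) ((A : ℝ) + ρ) = _
    rw [hL]
    -- expand the witnesses and swap the sums
    have hE : ∀ m ∈ range (nF + 1), ∀ j, evalR (as (nF - m) j) ρ =
        ∑ i ∈ range (D + 1), (as (nF - m) j).getD i 0 * ρ ^ i := fun m hm j =>
      (HRTM.sum_getD_eq_evalR ρ (as (nF - m) j) (D + 1) (hlen _ (by have := mem_range.mp hm; omega) j)).symm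
    calc ∑ m ∈ range (nF + 1), ∑ j ∈ range (ℓ + (nF - m) + 1), evalR (as (nF - m) j) ρ * (α (nF - m) * β j)
        = ∑ m ∈ range (nF + 1), ∑ j ∈ range (ℓ + (nF - m) + 1), ∑ i ∈ range (D + 1),
            α (nF - m) * ((as (nF - m) j).getD i 0 * β j) * ρ ^ i := by
          refine sum_congr rfl fun m hm => sum_congr rfl fun j _ => ?_
          rw [hE m hm j, sum_mul]
          exact sum_congr rfl fun i _ => by ring
      _ = ∑ m ∈ range (nF + 1), ∑ i ∈ range (D + 1), ∑ j ∈ range (ℓ + (nF - m) + 1),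
            α (nF - m) * ((as (nF - m) j).getD i 0 * β j) * ρ ^ i :=
          sum_congr rfl fun m _ => sum_comm
      _ = ∑ i ∈ range (D + 1), ∑ m ∈ range (nF + 1), ∑ j ∈ range (ℓ + (nF - m) + 1),
            α (nF - m) * ((as (nF - m) j).getD i 0 * β j) * ρ ^ i := sum_comm
      _ = ∑ i ∈ range (D + 1), g i * ρ ^ i := by
          refine sum_congr rfl fun i _ => ?_
          rw [hg, sum_mul]
          refine sum_congr rfl fun m _ => ?_
          rw [mul_sum, sum_mul]

end PKTM

end Literature.MathematicalPhysics.QuantumFieldTheory.ConformalBootstrap3D
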